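import Summits.BirchSwinnertonDyer.BirchSwinnertonDyer.Theses.KatoDescentTamePotSupersingular
import Summits.BirchSwinnertonDyer.BirchSwinnertonDyer.Theorems.KatoDescentTamePotSupersingularReducibleKatoMemberOfZetaInputs
import HarnessLib

/-!
# Glue item `ReducibleKatoMemberOfZetaInputsT` (K8-t′; ZETA family of crux M `ReducibleKatoMember`, item 19196;
glue item stmt-BirchSwinnertonDyer-20300, rendered by the zeta resplit of 2026-08-27, KT rev 24)

`PublishedInputNewformKatoZT → PublishedInputMemberHullZetaInputsT → PublishedInputRankEqAnalyticRankZT →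
ReducibleKatoMember`, closed in one line BY NAME from the landed kernel closer
`Theorems.tameReducibleKatoMember_of_memberHullZetaInputs` (bsd-potss-rkm g10, p522703).  Certified in plan g22's
`RKM19196ZetaSplitSketch_v1_1.lean` (`closes_kt_byName`, rc 0).  Nothing else assumed; BSD is proved for no curve
by this file (the three antecedents are held by-name aliases of named facts in print).
-/

set_option autoImplicit false
set_option linter.dupNamespace false

namespace Summit.BirchSwinnertonDyer.BirchSwinnertonDyer.Theorems

/-- **Glue item `ReducibleKatoMemberOfZetaInputsT` (type = the route decl verbatim).**
[cite: Kato2004Asterisque, Thm. 12.4 (2) (p. 221), Thm. 12.5 (p. 222), 13.14 (p. 234), §14.14 (p. 243)]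
[cite: Darmon2004, Thm. 3.22] -/
theorem reducibleKatoMemberOfZetaInputsT_proof :
    Summit.BirchSwinnertonDyer.BirchSwinnertonDyer.Theses.KatoDescentTamePotSupersingular.ReducibleKatoMemberOfZetaInputsT :=
  fun hN hZ hG => tameReducibleKatoMember_of_memberHullZetaInputs hN hZ hG

end Summit.BirchSwinnertonDyer.BirchSwinnertonDyer.Theorems
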